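import Mathlib
import Summits.NavierStokesRegularity.FluidComputer.AbstractPoincareTailForms
import Summits.NavierStokesRegularity.FluidComputer.FrequencyCutoffPoincare
import Summits.NavierStokesRegularity.FluidComputer.AbcFlowH1TailForm
import Summits.NavierStokesRegularity.FluidComputer.AbcFlowL2TailForm
import HarnessLib

/-!
# The three tail levels of the ABC linearisation for the CUBE tail `|k|_∞ ≥ K + 1`, with `(K+1)²` literally (cap g5, cell `ns-blowup`, 2026-08-26)

HONEST FRAMING (human ruling D-0035): nothing here is a claim about Navier–Stokes blow-up.
WHAT THIS IS NOT: not NS evidence. Closes the gap named in cap g5's ERRATUM (STATUS ≈ l.3220):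
`AbcFlowFrobeniusConstants.abc_tail_form_le`, `AbcFlowH1TailForm.abc_h1_tail_form_le`,
`AbcFlowL2TailForm.abc_l2_tail_form_le` are stated for BALL tails (`fourierTruncate N w = 0`,
constant `N² + 1`), which for the certificates' cube tail `|k|_∞ ≥ K + 1 = 25` only reach `577`.
Here the tail hypothesis is the certificates' own: «`𝓕w(k) = 0` for every `k` in the cube
`|k|_∞ ≤ K`», and the constants come out with `(K+1)²` LITERALLY — via the frequency-cutoff Poincaré
inequalities at `M = (K+1)²` (`FrequencyCutoffPoincare`) and the abstract-`Λ` tail forms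
(`AbstractPoincareTailForms`), for `U = Literature.Analysis.FluidPDE.Torus.abcFlow 1 1 1` on the unit
torus (`X = 2πx`; the operator `νΔ − [(U·∇)· + (·∇)U]` on `(ℝ/2πℤ)³` is `(ν/4π²)Δ − (1/2π)[…]` here):

* `abc_cube_l2_tail_form_le` — (T0) `… ≤ (−ν(K+1)² + √2 − x)·‖w‖₂²` (= `−m_t`, SKEWCUT-CERT Thm 1′);
* `abc_cube_h1_tail_form_le` — (T1) `… ≤ (−ν(K+1)² − ω + (√3+√2) + √3/(K+1))·‖∇w‖₂²` (= `−η₁'`);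
* `abc_cube_h2_tail_form_le` — (T2) `… ≤ (−ν(K+1)² − ω + (2√3+√2) + (√6+2√3)/(K+1) + √3/(K+1)²)·‖Δw‖₂²`
  (= `−η₂`, INSTAB-BRIDGE §11 l.109; at `R = 100`, `ω = 0.22`, `K + 1 = 25` this is the
  `η_t = 1.35236…` the D2 ball stage used, `AbcKappa0TailLevels.eta2_at_25_bounds`).

Mathlib + the cited FluidComputer files; no new definitions.
-/

noncomputable section

namespace Summit.NavierStokesRegularity.FluidComputer.AbcFlowCubeTailForms

open Literature.Analysis.FluidPDE Literature.Analysis.FunctionSpaces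
open Literature.Analysis.FunctionSpaces.Torus MeasureTheory UnitAddTorus
open Summit.NavierStokesRegularity.FluidComputer.AbcFlowFrobeniusConstants
open Summit.NavierStokesRegularity.FluidComputer.AbcFlowH1TailForm
open Summit.NavierStokesRegularity.FluidComputer.FrequencyCutoffPoincare
open Summit.NavierStokesRegularity.FluidComputer.AbstractPoincareTailForms
open scoped RealInnerProductSpace

/-- Every index of `Fin 3` is `0`, `1` or `2`. -/
private theorem fin3_cases (i : Fin 3) : i = 0 ∨ i = 1 ∨ i = 2 := by
  fin_cases i <;> simp

/-- **(T0) for the cube tail: the `L²` tail sentence `m_t = x + ν(K+1)² − √2` literally.** For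
`U = abc(1,1,1)` on the unit torus, every smooth `w` whose Fourier coefficients vanish on the cube
`|k|_∞ ≤ K`, `ν ≥ 0`, `x ∈ ℝ`:
`(ν/4π²)∫⟪Δw, w⟫ − (1/2π)∫⟪(U·∇)w + (w·∇)U, w⟫ − x‖w‖₂² ≤ (−ν(K+1)² + √2 − x)·‖w‖₂²`. -/
theorem abc_cube_l2_tail_form_le {w : UnitAddTorus (Fin 3) → EuclideanSpace ℝ (Fin 3)} (hw : IsSmooth w)
    {K : ℕ} (hcube : ∀ k : Fin 3 → ℤ, (∀ i, |k i| ≤ (K : ℤ)) →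
      mFourierCoeff (EuclideanSpace.complexify ∘ w) k = 0)
    {ν : ℝ} (hν : 0 ≤ ν) (x : ℝ) :
    ν / (4 * Real.pi ^ 2) * (∫ y, ⟪laplacian w y, w y⟫)
      - 1 / (2 * Real.pi) * (∫ y, ⟪convect (Torus.abcFlow 1 1 1) w y + convect w (Torus.abcFlow 1 1 1) y, w y⟫)
      - x * (∫ y, ‖w y‖ ^ 2)
      ≤ (-(ν * ((K : ℝ) + 1) ^ 2) + Real.sqrt 2 - x) * (∫ y, ‖w y‖ ^ 2) := by
  set U := Torus.abcFlow (1:ℝ) 1 1 with hU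
  have hπ : 0 < Real.pi := Real.pi_pos
  have h2π : 0 < 2 * Real.pi := by positivity
  have hM0 : 0 ≤ ((K : ℝ) + 1) ^ 2 := by positivity
  have hcut := coeff_eq_zero_of_cube_tail (w := w) hcube
  have hP0 : 4 * Real.pi ^ 2 * ((K : ℝ) + 1) ^ 2 * (∫ y, ‖w y‖ ^ 2) ≤ gradNormSq w :=
    integral_norm_sq_le_of_coeff_eq_zero hw hM0 hcut
  have hS : ∀ (y : UnitAddTorus (Fin 3)) (a : EuclideanSpace ℝ (Fin 3)),
      |⟪a, Torus.fderiv U y a⟫| ≤ 2 * Real.pi * Real.sqrt 2 * ‖a‖ ^ 2 :=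
    fun y a => abs_inner_fderiv_abcFlow_le y a
  have hmain := l2_tail_form_le_of_poincare (Torus.isSmooth_abcFlow 1 1 1)
    (Torus.isDivFree_abcFlow 1 1 1) hw hP0 (ν := ν / (2 * Real.pi)) (ω := 2 * Real.pi * x)
    (div_nonneg hν h2π.le) hS
  set E : ℝ := ∫ y, ‖w y‖ ^ 2 with hE
  set I1 : ℝ := ∫ y, ⟪laplacian w y, w y⟫ with hI1
  set I2 : ℝ := ∫ y, ⟪convect U w y + convect w U y, w y⟫ with hI2
  have key : ν / (4 * Real.pi ^ 2) * I1 - 1 / (2 * Real.pi) * I2 - x * E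
      = (1 / (2 * Real.pi)) * (ν / (2 * Real.pi) * I1 - I2 - 2 * Real.pi * x * E) := by
    field_simp
    ring
  have key2 : (1 / (2 * Real.pi)) * ((-(ν / (2 * Real.pi) * (4 * Real.pi ^ 2 * ((K : ℝ) + 1) ^ 2))
        - 2 * Real.pi * x + 2 * Real.pi * Real.sqrt 2) * E)
      = (-(ν * ((K : ℝ) + 1) ^ 2) + Real.sqrt 2 - x) * E := by
    field_simp
    ring
  rw [key, ← key2]
  exact mul_le_mul_of_nonneg_left hmain (by positivity)

/-- **(T1) for the cube tail: the level `η₁' = ν(K+1)² + ω − (√3+√2) − √3/(K+1)` literally.** -/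
theorem abc_cube_h1_tail_form_le {w : UnitAddTorus (Fin 3) → EuclideanSpace ℝ (Fin 3)} (hw : IsSmooth w)
    {K : ℕ} (hcube : ∀ k : Fin 3 → ℤ, (∀ i, |k i| ≤ (K : ℤ)) →
      mFourierCoeff (EuclideanSpace.complexify ∘ w) k = 0)
    {ν ω : ℝ} (hν : 0 ≤ ν) :
    -(ν / (4 * Real.pi ^ 2) * ∫ y, ‖laplacian w y‖ ^ 2)
      + 1 / (2 * Real.pi) * (∫ y, ⟪convect (Torus.abcFlow 1 1 1) w y + convect w (Torus.abcFlow 1 1 1) y,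
          laplacian w y⟫)
      - ω * gradNormSq w
      ≤ (-(ν * ((K : ℝ) + 1) ^ 2) - ω + (Real.sqrt 3 + Real.sqrt 2)
          + Real.sqrt 3 / ((K : ℝ) + 1)) * gradNormSq w := by
  set U := Torus.abcFlow (1:ℝ) 1 1 with hU
  have hπ : 0 < Real.pi := Real.pi_pos
  have h2π : 0 < 2 * Real.pi := by positivity
  have hK1 : 0 < (K : ℝ) + 1 := by positivity
  have hM0 : 0 ≤ ((K : ℝ) + 1) ^ 2 := by positivity
  have hcut := coeff_eq_zero_of_cube_tail (w := w) hcube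
  set Λ : ℝ := 4 * Real.pi ^ 2 * ((K : ℝ) + 1) ^ 2 with hΛdef
  have hΛpos : 0 < Λ := by positivity
  have hP0 : Λ * (∫ y, ‖w y‖ ^ 2) ≤ gradNormSq w := integral_norm_sq_le_of_coeff_eq_zero hw hM0 hcut
  have hP1 : Λ * gradNormSq w ≤ ∫ y, ‖laplacian w y‖ ^ 2 := gradNormSq_le_of_coeff_eq_zero hw hM0 hcut
  -- host constants L = 2π, L' = 4π², s = 2π√2 (as in `AbcFlowH1TailForm.abc_h1_tail_form_le`)
  have hL : ∀ (k : Fin 3) (y : UnitAddTorus (Fin 3)), ‖partialDeriv k U y‖ ≤ 2 * Real.pi := by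
    intro k y
    have h := norm_sq_partialDeriv_abcFlow 1 1 1 y k
    have ha : Torus.abcAmp (1:ℝ) 1 1 k ^ 2 = 1 := by
      rcases fin3_cases k with rfl | rfl | rfl <;> simp [Torus.abcAmp]
    rw [ha, mul_one] at h
    have h' : ‖partialDeriv k U y‖ ^ 2 = (2 * Real.pi) ^ 2 := by rw [hU, h]; ring
    refine le_of_eq ?_
    calc ‖partialDeriv k U y‖ = Real.sqrt (‖partialDeriv k U y‖ ^ 2) := (Real.sqrt_sq (norm_nonneg _)).symm
      _ = Real.sqrt ((2 * Real.pi) ^ 2) := by rw [h']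
      _ = 2 * Real.pi := Real.sqrt_sq h2π.le
  have hL' : ∀ (k : Fin 3) (y : UnitAddTorus (Fin 3)),
      Real.sqrt (∑ j, ‖partialDeriv j (partialDeriv k U) y‖ ^ 2) ≤ 4 * Real.pi ^ 2 := by
    intro k y
    have h := sum_norm_sq_partialDeriv_partialDeriv_abcFlow_dir 1 1 1 y k
    have ha : Torus.abcAmp (1:ℝ) 1 1 k ^ 2 = 1 := by
      rcases fin3_cases k with rfl | rfl | rfl <;> simp [Torus.abcAmp]
    rw [ha, mul_one] at h
    rw [hU, h, show (16 * Real.pi ^ 4 : ℝ) = (4 * Real.pi ^ 2) ^ 2 by ring,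
      Real.sqrt_sq (by positivity)]
  have hS : ∀ (y : UnitAddTorus (Fin 3)) (a : EuclideanSpace ℝ (Fin 3)),
      |⟪a, Torus.fderiv U y a⟫| ≤ 2 * Real.pi * Real.sqrt 2 * ‖a‖ ^ 2 :=
    fun y a => abs_inner_fderiv_abcFlow_le y a
  have hmain := h1_tail_form_le_of_poincare (Torus.isSmooth_abcFlow 1 1 1)
    (Torus.isDivFree_abcFlow 1 1 1) hw hΛpos hP0 hP1 (ν := ν / (2 * Real.pi)) (ω := 2 * Real.pi * ω)
    (div_nonneg hν h2π.le) h2π.le (by positivity) hS hL hL'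
  set G : ℝ := gradNormSq w with hG
  set I1 : ℝ := ∫ y, ‖laplacian w y‖ ^ 2 with hI1
  set I2 : ℝ := ∫ y, ⟪convect U w y + convect w U y, laplacian w y⟫ with hI2
  have hcard : Real.sqrt (Fintype.card (Fin 3)) = Real.sqrt 3 := by simp
  have hsΛ : Real.sqrt Λ = 2 * Real.pi * ((K : ℝ) + 1) := by
    rw [hΛdef, show (4 * Real.pi ^ 2 * ((K : ℝ) + 1) ^ 2 : ℝ) = (2 * Real.pi * ((K : ℝ) + 1)) ^ 2 by ring,
      Real.sqrt_sq (by positivity)]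
  rw [hcard, hsΛ] at hmain
  have key : -(ν / (4 * Real.pi ^ 2) * I1) + 1 / (2 * Real.pi) * I2 - ω * G
      = (1 / (2 * Real.pi)) * (-(ν / (2 * Real.pi) * I1) + I2 - 2 * Real.pi * ω * G) := by
    field_simp
    ring
  have key2 : (1 / (2 * Real.pi)) * ((-(ν / (2 * Real.pi) * Λ)
        - 2 * Real.pi * ω + Real.sqrt 3 * (2 * Real.pi) + 2 * Real.pi * Real.sqrt 2
        + Real.sqrt 3 * (4 * Real.pi ^ 2) / (2 * Real.pi * ((K : ℝ) + 1))) * G)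
      = (-(ν * ((K : ℝ) + 1) ^ 2) - ω + (Real.sqrt 3 + Real.sqrt 2)
          + Real.sqrt 3 / ((K : ℝ) + 1)) * G := by
    rw [hΛdef]
    field_simp
    ring
  rw [key, ← key2]
  exact mul_le_mul_of_nonneg_left hmain (by positivity)

/-- **(T2) for the cube tail: THEOREM 3-L's tail level
`η₂ = ν(K+1)² + ω − (2√3+√2) − (√6+2√3)/(K+1) − √3/(K+1)²` literally** (INSTAB-BRIDGE §11 l.109). -/
theorem abc_cube_h2_tail_form_le {w : UnitAddTorus (Fin 3) → EuclideanSpace ℝ (Fin 3)} (hw : IsSmooth w)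
    {K : ℕ} (hcube : ∀ k : Fin 3 → ℤ, (∀ i, |k i| ≤ (K : ℤ)) →
      mFourierCoeff (EuclideanSpace.complexify ∘ w) k = 0)
    {ν ω : ℝ} (hν : 0 ≤ ν) :
    ν / (4 * Real.pi ^ 2) * (∫ y, ⟪laplacian (laplacian w) y, laplacian w y⟫)
      - 1 / (2 * Real.pi) * (∫ y, ⟪convect (Torus.abcFlow 1 1 1) w y + convect w (Torus.abcFlow 1 1 1) y,
          laplacian (laplacian w) y⟫)
      - ω * (∫ y, ‖laplacian w y‖ ^ 2)
      ≤ (-(ν * ((K : ℝ) + 1) ^ 2) - ω + (2 * Real.sqrt 3 + Real.sqrt 2)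
          + (Real.sqrt 6 + 2 * Real.sqrt 3) / ((K : ℝ) + 1)
          + Real.sqrt 3 / ((K : ℝ) + 1) ^ 2) * (∫ y, ‖laplacian w y‖ ^ 2) := by
  set U := Torus.abcFlow (1:ℝ) 1 1 with hU
  have hπ : 0 < Real.pi := Real.pi_pos
  have h2π : 0 < 2 * Real.pi := by positivity
  have hK1 : 0 < (K : ℝ) + 1 := by positivity
  have hM0 : 0 ≤ ((K : ℝ) + 1) ^ 2 := by positivity
  have hcut := coeff_eq_zero_of_cube_tail (w := w) hcube
  set Λ : ℝ := 4 * Real.pi ^ 2 * ((K : ℝ) + 1) ^ 2 with hΛdef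
  have hΛpos : 0 < Λ := by positivity
  have hP0 : Λ * (∫ y, ‖w y‖ ^ 2) ≤ gradNormSq w := integral_norm_sq_le_of_coeff_eq_zero hw hM0 hcut
  have hP1 : Λ * gradNormSq w ≤ ∫ y, ‖laplacian w y‖ ^ 2 := gradNormSq_le_of_coeff_eq_zero hw hM0 hcut
  have hP2 : Λ * (∫ y, ‖laplacian w y‖ ^ 2) ≤ gradNormSq (laplacian w) :=
    integral_norm_laplacian_sq_le_of_coeff_eq_zero hw hM0 hcut
  -- the five Frobenius constants (as in `AbcFlowFrobeniusConstants.abc_tail_form_le`)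
  have hF : ∀ y : UnitAddTorus (Fin 3), ∑ j, ‖partialDeriv j U y‖ ^ 2 ≤ (2 * Real.pi * Real.sqrt 3) ^ 2 := by
    intro y
    rw [hU, sum_norm_sq_partialDeriv_abcFlow, mul_pow, Real.sq_sqrt (by norm_num : (0:ℝ) ≤ 3)]
    nlinarith [sq_nonneg Real.pi]
  have hL₂ : ∀ y : UnitAddTorus (Fin 3), ‖laplacian U y‖ ≤ 4 * Real.pi ^ 2 * Real.sqrt 6 := by
    intro y
    have h := norm_laplacian_abcFlow_le 1 1 1 y
    norm_num at h
    rw [hU]; exact h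
  have hP : ∀ y : UnitAddTorus (Fin 3),
      ∑ m, ∑ j, ‖partialDeriv j (partialDeriv m U) y‖ ^ 2 ≤ (4 * Real.pi ^ 2 * Real.sqrt 3) ^ 2 := by
    intro y
    rw [hU, sum_sum_norm_sq_partialDeriv_partialDeriv_abcFlow, mul_pow,
      Real.sq_sqrt (by norm_num : (0:ℝ) ≤ 3)]
    nlinarith [sq_nonneg (Real.pi ^ 2)]
  have hQ : ∀ y : UnitAddTorus (Fin 3),
      ∑ j, ‖partialDeriv j (laplacian U) y‖ ^ 2 ≤ (8 * Real.pi ^ 3 * Real.sqrt 3) ^ 2 := by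
    intro y
    rw [hU, sum_norm_sq_partialDeriv_laplacian_abcFlow, mul_pow,
      Real.sq_sqrt (by norm_num : (0:ℝ) ≤ 3)]
    nlinarith [sq_nonneg (Real.pi ^ 3)]
  have hS : ∀ (y : UnitAddTorus (Fin 3)) (a : EuclideanSpace ℝ (Fin 3)),
      |⟪∑ j, a j • partialDeriv j U y, a⟫| ≤ 2 * Real.pi * Real.sqrt 2 * ‖a‖ ^ 2 :=
    fun y a => abs_inner_strain_abcFlow_le y a
  have hmain := sharp_tail_form_le_of_poincare (Torus.isSmooth_abcFlow 1 1 1)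
    (Torus.isDivFree_abcFlow 1 1 1) hw hΛpos hP0 hP1 hP2 (ν := ν / (2 * Real.pi)) (ω := 2 * Real.pi * ω)
    (div_nonneg hν h2π.le) (by positivity) (by positivity) (by positivity) hS hF hL₂ hP hQ
  set Y : ℝ := ∫ y, ‖laplacian w y‖ ^ 2 with hY
  set I1 : ℝ := ∫ y, ⟪laplacian (laplacian w) y, laplacian w y⟫ with hI1
  set I2 : ℝ := ∫ y, ⟪convect U w y + convect w U y, laplacian (laplacian w) y⟫ with hI2
  have hsΛ : Real.sqrt Λ = 2 * Real.pi * ((K : ℝ) + 1) := by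
    rw [hΛdef, show (4 * Real.pi ^ 2 * ((K : ℝ) + 1) ^ 2 : ℝ) = (2 * Real.pi * ((K : ℝ) + 1)) ^ 2 by ring,
      Real.sqrt_sq (by positivity)]
  rw [hsΛ] at hmain
  have key : ν / (4 * Real.pi ^ 2) * I1 - 1 / (2 * Real.pi) * I2 - ω * Y
      = (1 / (2 * Real.pi)) * (ν / (2 * Real.pi) * I1 - I2 - 2 * Real.pi * ω * Y) := by
    field_simp
    ring
  have key2 : (1 / (2 * Real.pi)) * ((-(ν / (2 * Real.pi) * Λ)
        - 2 * Real.pi * ω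
        + (2 * (2 * Real.pi * Real.sqrt 3) + 2 * Real.pi * Real.sqrt 2)
        + (4 * Real.pi ^ 2 * Real.sqrt 6 + 2 * (4 * Real.pi ^ 2 * Real.sqrt 3))
            / (2 * Real.pi * ((K : ℝ) + 1))
        + 8 * Real.pi ^ 3 * Real.sqrt 3 / Λ) * Y)
      = (-(ν * ((K : ℝ) + 1) ^ 2) - ω + (2 * Real.sqrt 3 + Real.sqrt 2)
          + (Real.sqrt 6 + 2 * Real.sqrt 3) / ((K : ℝ) + 1)
          + Real.sqrt 3 / ((K : ℝ) + 1) ^ 2) * Y := by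
    rw [hΛdef]
    field_simp
    ring
  rw [key, ← key2]
  exact mul_le_mul_of_nonneg_left hmain (by positivity)

end Summit.NavierStokesRegularity.FluidComputer.AbcFlowCubeTailForms
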